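import Summits.Ventures.HodgeKum4.Theses.KummerFixedLocus
import Summits.Ventures.HodgeKum4.Theorems.KummerFixedLocusKummerRangeEqInvariants
import HarnessLib

/-!
# Route KummerFixedLocus (`hodge-kum4`, rung H3) — the lane-(V) bridge item `KummerRangeEqInvariants` CLOSES (kernel)

Seat p1 (g4).  Item `stmt-Ventures-20352` (route file rev 27, ruling (C-b′) of director-hodge g7 / planner g18,
2026-08-27): the route decl
`Summit.Ventures.HodgeKum4.Theses.KummerFixedLocus.KummerRangeEqInvariants :=
Literature.AlgebraicGeometry.HilbertScheme.Beauville1983_kummerCover_galois →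
Literature.AlgebraicGeometry.Hyperkaehler.BNWS2011_autFixingH2H3_generalizedKummer →
Summit.Ventures.HodgeKum4.KummerRangeEqInvariants` — the bridge `im θ* = H*(K)^{Γ(K)}` (`n ≥ 2`) with its two
REFEREED print inputs (Beauville's Galois cover `A × Kⁿ(A) → A^[n+1]`; BNWS 2011 / Oguiso 2020 / Foster 2024:
`Γ(Kⁿ(A))` = the Kummer translations) as leading binders — is PROVED OUTRIGHT by the kernel theorem
`kummerRangeEqInvariants_of_print` (`Theorems/KummerFixedLocusKummerRangeEqInvariants.lean`, p523665): transfer for the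
finite Galois cover + restriction along the unit section.  UNCONDITIONAL as typed (the print facts ARE the item's
hypotheses; axioms standard).  HONEST FRAMING: a support item of the lane-(V) line closes; nothing here says V0,
`LefschetzGenerationKum4`, `HC_Kum4Type` or HC is proved.
-/

noncomputable section

namespace Summit.Ventures.HodgeKum4

/-- **Item stmt-Ventures-20352 (kernel)**: the route decl `KummerRangeEqInvariants` of `Theses.KummerFixedLocus` —
`Beauville1983_kummerCover_galois → BNWS2011_autFixingH2H3_generalizedKummer → KummerRangeEqInvariants` — holds, by
`kummerRangeEqInvariants_of_print`. -/
theorem kummerRangeEqInvariants_holds :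
    Summit.Ventures.HodgeKum4.Theses.KummerFixedLocus.KummerRangeEqInvariants := by
  unfold Summit.Ventures.HodgeKum4.Theses.KummerFixedLocus.KummerRangeEqInvariants
  exact fun hGal hBNWS ↦ kummerRangeEqInvariants_of_print hGal hBNWS

end Summit.Ventures.HodgeKum4

end
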